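import Summits.QuantumFields.YangMills.Theorems.WeakCouplingRatesColdBoxOneScaleDefs
import Summits.QuantumFields.YangMills.Theorems.WeakCouplingRatesColdBoxDirichletLargeField

/-!
# Cruxes `ColdBoxTwoPointFloorW` (S3c trunk F7) and `BulkDominatesColdBoxW` (expansion stubs): Gaussian large fields in the THREE-COLOUR
# reference `gauss3 H = boxDirichlet H ^{⊗3}`

Three-colour form of `measureReal_boxDirichlet_exists_abs_dirCirc_ge_le` (`Theorems/WeakCouplingRatesColdBoxDirichletLargeField.lean`), in the
vocabulary of the one-scale assembly (`TSpace`, `gauss3`, `Theorems/WeakCouplingRatesColdBoxOneScaleDefs.lean`, seat `ym-wcr-19456-p1`):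

* `measureReal_gauss3_colour_preimage` — `gauss3{t : t_i ∈ A} = D(A)` (marginals);
* **`measureReal_gauss3_exists_abs_dirCirc_ge_le`** — `gauss3{∃ i, ∃ p touching Λ_H, R ≤ |s_i(p)|} ≤ 6·#(plaquettesTouching Λ_H)·e^{−R²/2}`;
* `measureReal_gauss3_not_smallField_le` — complement form over all colours and ALL plaquettes: `≤ 720(2H+1)⁴e^{−R²/2}`;
* `qObs_le_of_smallField` — on the small-field region `qObs H p t ≤ (3/2)R²` for every plaquette (the Gaussian surrogate is bounded there,
  the input of the `L∞` tilt/conditioning lemmas).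

Fleet seat `ym-spine-20043-p1` (g3; Gaussian side of the work split with `ym-wcr-19609-p1`).  No sorry, standard axioms, no new definition, no named-fact
hypothesis.  NOT a claim about the mass gap.
-/

set_option autoImplicit false

noncomputable section

open MeasureTheory Finset Real
open Literature.Probability.LatticeModels
open Literature.MathematicalPhysics.QuantumLattice
open Literature.MathematicalPhysics.QuantumFieldTheory
open Literature.MathematicalPhysics.QuantumFieldTheory.LatticeMaxwell
open Literature.MathematicalPhysics.QuantumFieldTheory.AxialGauge

namespace Summit.QuantumFields.YangMills.Theorems.WeakCouplingRates

variable {H : ℕ}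

/-- Marginals of `gauss3`: `gauss3{t : t_i ∈ A} = boxDirichlet(A)` for measurable `A`. -/
theorem measureReal_gauss3_colour_preimage (i : Fin 3) {A : Set (EuclideanSpace ℝ (DirFree H))} (hA : MeasurableSet A) :
    (gauss3 H).real {t | t i ∈ A} = (boxDirichlet H).real A := by
  have h := (MeasureTheory.measurePreserving_eval (μ := fun _ : Fin 3 => boxDirichlet H) i).measure_preimage hA.nullMeasurableSet
  rw [measureReal_def, measureReal_def]
  exact congrArg ENNReal.toReal h

/-- The one-colour bad set is measurable. -/
theorem measurableSet_exists_abs_dirCirc_ge (H : ℕ) (R : ℝ) :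
    MeasurableSet {s : EuclideanSpace ℝ (DirFree H) |
      ∃ p ∈ plaquettesTouching (boxEdges 4 (2 * H + 1)), R ≤ |dirCirc H (p.1, p.2.1.1, p.2.1.2) s|} := by
  have hset : {s : EuclideanSpace ℝ (DirFree H) | ∃ p ∈ plaquettesTouching (boxEdges 4 (2 * H + 1)), R ≤ |dirCirc H (p.1, p.2.1.1, p.2.1.2) s|} =
      ⋃ p ∈ plaquettesTouching (boxEdges 4 (2 * H + 1)), {s | R ≤ |dirCirc H (p.1, p.2.1.1, p.2.1.2) s|} := by
    ext s; simp
  rw [hset]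
  refine MeasurableSet.biUnion (Finset.countable_toSet _) fun p _ => ?_
  exact measurableSet_le measurable_const ((measurable_dirCirc _).abs)

/-- **Gaussian large fields, three colours**: for `R ≥ 0`,
`gauss3{∃ i, ∃ p touching Λ_H, R ≤ |s_i(p)|} ≤ 6·#(plaquettesTouching Λ_H)·e^{−R²/2}`. -/
theorem measureReal_gauss3_exists_abs_dirCirc_ge_le (H : ℕ) {R : ℝ} (hR : 0 ≤ R) :
    (gauss3 H).real {t | ∃ i : Fin 3, ∃ p ∈ plaquettesTouching (boxEdges 4 (2 * H + 1)), R ≤ |dirCirc H (p.1, p.2.1.1, p.2.1.2) (t i)|} ≤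
      6 * #(plaquettesTouching (boxEdges 4 (2 * H + 1))) * Real.exp (-R ^ 2 / 2) := by
  set A : Set (EuclideanSpace ℝ (DirFree H)) :=
    {s | ∃ p ∈ plaquettesTouching (boxEdges 4 (2 * H + 1)), R ≤ |dirCirc H (p.1, p.2.1.1, p.2.1.2) s|} with hA
  have hAm : MeasurableSet A := measurableSet_exists_abs_dirCirc_ge H R
  have hset : {t : TSpace H | ∃ i : Fin 3, ∃ p ∈ plaquettesTouching (boxEdges 4 (2 * H + 1)), R ≤ |dirCirc H (p.1, p.2.1.1, p.2.1.2) (t i)|} =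
      ⋃ i ∈ (Finset.univ : Finset (Fin 3)), {t : TSpace H | t i ∈ A} := by
    ext t; simp [hA]
  rw [hset]
  refine (measureReal_biUnion_finset_le _ _).trans ?_
  have hone : ∀ i : Fin 3, (gauss3 H).real {t : TSpace H | t i ∈ A} ≤ 2 * #(plaquettesTouching (boxEdges 4 (2 * H + 1))) * Real.exp (-R ^ 2 / 2) := by
    intro i
    rw [measureReal_gauss3_colour_preimage i hAm]
    exact measureReal_boxDirichlet_exists_abs_dirCirc_ge_le H hR
  calc ∑ i ∈ (Finset.univ : Finset (Fin 3)), (gauss3 H).real {t : TSpace H | t i ∈ A}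
      ≤ ∑ _i ∈ (Finset.univ : Finset (Fin 3)), 2 * #(plaquettesTouching (boxEdges 4 (2 * H + 1))) * Real.exp (-R ^ 2 / 2) :=
        Finset.sum_le_sum fun i _ => hone i
    _ = 6 * #(plaquettesTouching (boxEdges 4 (2 * H + 1))) * Real.exp (-R ^ 2 / 2) := by
        rw [Finset.sum_const, Finset.card_univ, Fintype.card_fin]; simp only [nsmul_eq_mul, Nat.cast_ofNat]; ring

/-- **Complement form**: for `R ≥ 0` the `gauss3`-mass of the complement of «every colour circulation of every plaquette of `ℤ⁴` is at most `R` in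
absolute value» is at most `720(2H+1)⁴e^{−R²/2}`. -/
theorem measureReal_gauss3_not_smallField_le (H : ℕ) {R : ℝ} (hR : 0 ≤ R) :
    (gauss3 H).real {t | ¬ ∀ i : Fin 3, ∀ p : ZdPlaquette 4, |dirCirc H (p.1, p.2.1.1, p.2.1.2) (t i)| ≤ R} ≤
      720 * (2 * (H : ℝ) + 1) ^ 4 * Real.exp (-R ^ 2 / 2) := by
  have hsub : {t : TSpace H | ¬ ∀ i : Fin 3, ∀ p : ZdPlaquette 4, |dirCirc H (p.1, p.2.1.1, p.2.1.2) (t i)| ≤ R} ⊆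
      {t | ∃ i : Fin 3, ∃ p ∈ plaquettesTouching (boxEdges 4 (2 * H + 1)), R ≤ |dirCirc H (p.1, p.2.1.1, p.2.1.2) (t i)|} := by
    intro t ht
    simp only [Set.mem_setOf_eq, not_forall, not_le] at ht ⊢
    obtain ⟨i, p, hp⟩ := ht
    by_cases hmem : p ∈ plaquettesTouching (boxEdges 4 (2 * H + 1))
    · exact ⟨i, p, hmem, hp.le⟩
    · exfalso
      have h0 : dirCirc H (p.1, p.2.1.1, p.2.1.2) (t i) = 0 := sCirc_dirGlue_eq_zero_of_not_touching _ hmem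
      rw [h0, abs_zero] at hp
      linarith
  have hcard : (#(plaquettesTouching (boxEdges 4 (2 * H + 1))) : ℝ) ≤ 120 * (2 * (H : ℝ) + 1) ^ 4 := by
    have h := card_plaquettesTouching_boxEdges_le (2 * H + 1)
    have : ((#(plaquettesTouching (boxEdges 4 (2 * H + 1))) : ℕ) : ℝ) ≤ ((120 * (2 * H + 1) ^ 4 : ℕ) : ℝ) := by exact_mod_cast h
    push_cast at this
    exact this
  calc (gauss3 H).real {t | ¬ ∀ i : Fin 3, ∀ p : ZdPlaquette 4, |dirCirc H (p.1, p.2.1.1, p.2.1.2) (t i)| ≤ R}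
      ≤ (gauss3 H).real {t | ∃ i : Fin 3, ∃ p ∈ plaquettesTouching (boxEdges 4 (2 * H + 1)), R ≤ |dirCirc H (p.1, p.2.1.1, p.2.1.2) (t i)|} :=
        measureReal_mono hsub
    _ ≤ 6 * #(plaquettesTouching (boxEdges 4 (2 * H + 1))) * Real.exp (-R ^ 2 / 2) := measureReal_gauss3_exists_abs_dirCirc_ge_le H hR
    _ ≤ 6 * (120 * (2 * (H : ℝ) + 1) ^ 4) * Real.exp (-R ^ 2 / 2) := by gcongr
    _ = 720 * (2 * (H : ℝ) + 1) ^ 4 * Real.exp (-R ^ 2 / 2) := by ring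

/-- **The Gaussian surrogate is bounded on the small-field region**: if every colour circulation of `p` is at most `R` in absolute value then
`qObs H p t ≤ (3/2)·R²`. -/
theorem qObs_le_of_smallField (p : Plaq 4) (t : TSpace H) {R : ℝ} (h : ∀ i : Fin 3, |dirCirc H p (t i)| ≤ R) :
    qObs H p t ≤ 3 / 2 * R ^ 2 := by
  unfold qObs
  have hle : ∀ i : Fin 3, dirCirc H p (t i) ^ 2 ≤ R ^ 2 := fun i => by
    have := h i
    rw [← sq_abs]
    exact pow_le_pow_left₀ (abs_nonneg _) this 2
  have hs : ∑ i : Fin 3, dirCirc H p (t i) ^ 2 ≤ ∑ _i : Fin 3, R ^ 2 := Finset.sum_le_sum fun i _ => hle i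
  rw [Finset.sum_const, Finset.card_univ, Fintype.card_fin] at hs
  simp only [nsmul_eq_mul, Nat.cast_ofNat] at hs
  linarith

end Summit.QuantumFields.YangMills.Theorems.WeakCouplingRates

end
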